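import Literature.RepresentationTheory.FiniteGroups.KLRGradedCellularBasis
import Mathlib.Tactic.LinearCombination
import HarnessLib

/-!
# Brundan–Kleshchev–Wang, Prop. 3.14: the degree of a standard tableau under an admissible
transposition

Hu–Mathas 2010 (arXiv:0907.2985, §4.3–§5) compute the degree of their basis elements
`ψ_{𝔰𝔱} = ψ*_{d(𝔰)} e_λ y_λ ψ_{d(𝔱)}` from the Brundan–Kleshchev–Wang identity
(J. Brundan, A. Kleshchev, W. Wang, *Graded Specht modules*, Crelle 655 (2011), arXiv:0901.0218,
Proposition 3.14): if `𝔱` is standard, `r, r+1` sit in the nodes `B` (above) and `A` (below,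
hence strictly to the left) of `𝔱`, and `𝔰 = s_r 𝔱`, then

  `deg 𝔰 - deg 𝔱 = -a_{i_r, i_{r+1}}`,  `𝐢^𝔱 = (i_1, …, i_n)`,

`a_{ij}` the Cartan integer of the quiver `ℤ/p` (`2` if `i = j`, `-1` if `i - j = ±1` and
`p ≠ 2`, `-2` if `i - j = ±1` and `p = 2`, `0` otherwise; `degCartan`). This file proves it for
the tree's `tableauDegree` on growth sequences `f : Fin n → ℕ × ℕ`
(`tableauDegree_comp_swap_sub`), with exactly the hypotheses the argument uses: the shape `μ` of
the entries `≤ r+1` is a lower set of cells, `f` is injective, `A` is strictly below and strictly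
left of `B`, and `A`, `B` are end-of-row/end-of-column cells of `μ` (all automatic for a standard
tableau of a Young diagram). The proof is BKW's: the steps `k ≠ r, r+1` of the two degree sums
agree (`tableauDegreeStep_comp_swap_of_ne`); with `ν` the shape of the entries `< r` the remaining
steps are `d_B(ν ∪ B) + d_A(μ)` for `𝔱` and `d_A(ν ∪ A) + d_B(μ)` for `𝔰`; `d_A(ν ∪ A) = d_A(μ)`
because removing `B` from `μ` only changes addable/removable nodes in rows `≤ row B + 1 ≤ row A`
(`degCount_erase_of_lt`), and `d_B(μ ∖ A) - d_B(μ) = a_{res A, res B}` by the local analysis of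
the addable and removable nodes of `μ ∖ A` (`isAddableNode_erase_iff`,
`isRemovableNode_erase_iff`, `degCount_erase_sub`).

Then the chains along which Hu–Mathas read off `deg ψ_{d(𝔱)} e(𝐢^λ) = deg 𝔱 - deg 𝔱^λ`
(BKW §3.3 and Cor. 3.15): `isStdFilling_comp_swap` (BKW Lemma 3.3: `s_r 𝔱` is standard when the
cells of `r`, `r + 1` are incomparable), `tableauDegree_chain_sub` (Prop. 3.14 telescoped along an
admissible chain), the row-inversion count `rowInv` (`= ℓ(w_𝔱)`; an adjacent row inversion exists
when it is positive, `exists_adjacent_rowInv`, and an admissible step removes exactly one,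
`rowInv_comp_swap`), and `exists_admissible_chain`: every standard tableau ends a descending
admissible chain of length `rowInv 𝔱` from a tableau without row inversions; such a tableau is
the row-reading tableau `𝔱^λ` (`rowReading`, `eq_rowReading_of_rowInv_eq_zero`: two standard
tableaux without row inversions coincide, `eq_of_rowInv_eq_zero`), whence Hu–Mathas' form
`exists_chain_tableauDegree_sub_rowReading`: `deg 𝔱 - deg 𝔱^λ = -∑_k a_{res(r_k), res(r_k+1)}`
along a descending admissible chain `𝔱^λ → ⋯ → 𝔱` of length `ℓ(d(𝔱))`.

## References

* J. Brundan, A. Kleshchev, W. Wang, *Graded Specht modules*, J. reine angew. Math. 655 (2011)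
  61–87, arXiv:0901.0218, §3.5 (degree of a standard tableau), Proposition 3.14.
  [BrundanKleshchevWang2011]
* J. Hu, A. Mathas, *Graded cellular bases for the cyclotomic Khovanov–Lauda–Rouquier algebras of
  type A*, Adv. Math. 225 (2010), arXiv:0907.2985, §4.3 (degrees of `ψ_{d(𝔱)} e(𝐢^λ)`).
  [HuMathas2010]
-/

namespace Literature.RepresentationTheory.FiniteGroups

/-! ### Lower sets of cells and the local change of addable / removable nodes -/

/-- `μ` is a lower set of cells (a Young diagram given as a finite set): with a cell it contains
every cell weakly above and weakly to the left. [folklore] -/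
def IsCellLowerSet (μ : Finset (ℕ × ℕ)) : Prop :=
  ∀ ⦃x : ℕ × ℕ⦄, x ∈ μ → ∀ ⦃y : ℕ × ℕ⦄, y.1 ≤ x.1 → y.2 ≤ x.2 → y ∈ μ

variable {μ : Finset (ℕ × ℕ)} {a b : ℕ}

/-- **Addable nodes after removing a node `A = (a, b)`** of a lower set: `A` becomes addable, the
cells just below and just right of `A` stop being addable, nothing else changes. [folklore] -/
theorem isAddableNode_erase_iff (hμ : IsCellLowerSet μ) (hA : (a, b) ∈ μ) (x : ℕ × ℕ) :
    IsAddableNode (μ.erase (a, b)) x ↔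
      x = (a, b) ∨ (IsAddableNode μ x ∧ x ≠ (a + 1, b) ∧ x ≠ (a, b + 1)) := by
  simp only [IsAddableNode, Finset.mem_erase, ne_eq]
  constructor
  · rintro ⟨h1, h2, h3⟩
    by_cases hx : x = (a, b)
    · exact Or.inl hx
    · right
      have hxμ : x ∉ μ := fun h => h1 ⟨hx, h⟩
      refine ⟨⟨hxμ, h2.imp_right fun h => h.2, h3.imp_right fun h => h.2⟩, ?_, ?_⟩
      · rintro rfl
        rcases h2 with h | ⟨h, -⟩
        · simp at h
        · exact h (by simp)
      · rintro rfl
        rcases h3 with h | ⟨h, -⟩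
        · simp at h
        · exact h (by simp)
  · rintro (rfl | ⟨⟨hxμ, h2, h3⟩, hX1, hX2⟩)
    · refine ⟨fun h => h.1 rfl, ?_, ?_⟩
      · rcases Nat.eq_zero_or_pos a with h | h
        · exact Or.inl h
        · exact Or.inr ⟨fun e => by rw [Prod.ext_iff] at e; simp at e; omega, hμ hA (by simp) (by simp)⟩
      · rcases Nat.eq_zero_or_pos b with h | h
        · exact Or.inl h
        · exact Or.inr ⟨fun e => by rw [Prod.ext_iff] at e; simp at e; omega, hμ hA (by simp) (by simp)⟩
    · refine ⟨fun h => hxμ h.2, ?_, ?_⟩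
      · rcases h2 with h | h
        · exact Or.inl h
        · by_cases hx0 : x.1 = 0
          · exact Or.inl hx0
          · refine Or.inr ⟨fun e => hX1 ?_, h⟩
            rw [Prod.ext_iff] at e ⊢; simp only at e ⊢; omega
      · rcases h3 with h | h
        · exact Or.inl h
        · by_cases hx0 : x.2 = 0
          · exact Or.inl hx0
          · refine Or.inr ⟨fun e => hX2 ?_, h⟩
            rw [Prod.ext_iff] at e ⊢; simp only at e ⊢; omega

/-- **Removable nodes after removing a node `A = (a, b)`** of a lower set: `A` stops being
removable; the cell above `A` becomes removable iff the cell to its right is missing, the cell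
left of `A` becomes removable iff the cell below it is missing; nothing else changes. [folklore] -/
theorem isRemovableNode_erase_iff (hμ : IsCellLowerSet μ) (hA : (a, b) ∈ μ) (x : ℕ × ℕ) :
    IsRemovableNode (μ.erase (a, b)) x ↔
      x ≠ (a, b) ∧ (IsRemovableNode μ x ∨ (1 ≤ a ∧ x = (a - 1, b) ∧ (a - 1, b + 1) ∉ μ) ∨
        (1 ≤ b ∧ x = (a, b - 1) ∧ (a + 1, b - 1) ∉ μ)) := by
  simp only [IsRemovableNode, Finset.mem_erase, ne_eq, not_and]
  constructor
  · rintro ⟨⟨hne, hxμ⟩, h2, h3⟩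
    refine ⟨hne, ?_⟩
    by_cases hup : 1 ≤ a ∧ x = (a - 1, b)
    · obtain ⟨ha, rfl⟩ := hup
      right; left
      refine ⟨ha, rfl, fun h => ?_⟩
      have := h3 (fun e => by rw [Prod.ext_iff] at e; simp at e)
      exact this (by simpa using h)
    · by_cases hle : 1 ≤ b ∧ x = (a, b - 1)
      · obtain ⟨hb, rfl⟩ := hle
        right; right
        refine ⟨hb, rfl, fun h => ?_⟩
        have := h2 (fun e => by rw [Prod.ext_iff] at e; simp at e)
        exact this (by simpa using h)
      · left
        refine ⟨hxμ, fun h => h2 (fun e => hup ?_) h, fun h => h3 (fun e => hle ?_) h⟩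
        · obtain ⟨e1, e2⟩ := Prod.ext_iff.1 e
          simp only at e1 e2
          exact ⟨by omega, Prod.ext (by simp only; omega) (by simpa using e2)⟩
        · obtain ⟨e1, e2⟩ := Prod.ext_iff.1 e
          simp only at e1 e2
          exact ⟨by omega, Prod.ext (by simpa using e1) (by simp only; omega)⟩
  · rintro ⟨hne, h | ⟨ha, rfl, hmiss⟩ | ⟨hb, rfl, hmiss⟩⟩
    · obtain ⟨hxμ, h2, h3⟩ := h
      exact ⟨⟨hne, hxμ⟩, fun _ h => h2 h, fun _ h => h3 h⟩
    · exact ⟨⟨hne, hμ hA (by simp) (by simp)⟩, fun h _ => h (Prod.ext (by simp only; omega) rfl),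
        fun _ h => hmiss (by simpa using h)⟩
    · exact ⟨⟨hne, hμ hA (by simp) (by simp)⟩, fun _ h => hmiss (by simpa using h),
        fun h _ => h (Prod.ext rfl (by simp only; omega))⟩

/-! ### Counting -/

/-- `#(s ∖ x)` as an integer. [folklore] -/
theorem card_erase_int {α : Type*} [DecidableEq α] (s : Finset α) (x : α) :
    ((s.erase x).card : ℤ) = s.card - if x ∈ s then 1 else 0 := by
  by_cases h : x ∈ s
  · rw [if_pos h, Finset.card_erase_of_mem h, Nat.cast_sub (Finset.card_pos.2 ⟨x, h⟩)]; simp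
  · rw [if_neg h, Finset.erase_eq_of_notMem h]; simp

/-- `#(insert x s)` as an integer. [folklore] -/
theorem card_insert_int {α : Type*} [DecidableEq α] (s : Finset α) (x : α) :
    ((insert x s).card : ℤ) = s.card + if x ∈ s then 0 else 1 := by
  by_cases h : x ∈ s
  · rw [if_pos h, Finset.insert_eq_of_mem h]; simp
  · rw [if_neg h, Finset.card_insert_of_notMem h]; simp

/-- The set of addable nodes after removing a node of a lower set. [folklore] -/
theorem addableNodes_erase (hμ : IsCellLowerSet μ) (hA : (a, b) ∈ μ) :
    addableNodes (μ.erase (a, b)) = insert (a, b) (((addableNodes μ).erase (a + 1, b)).erase (a, b + 1)) := by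
  ext x
  simp only [mem_addableNodes, Finset.mem_insert, Finset.mem_erase, isAddableNode_erase_iff hμ hA, ne_eq]
  tauto

/-- The two candidate new removable nodes after removing `(a, b)`. [folklore] -/
def newRemovable (μ : Finset (ℕ × ℕ)) (a b : ℕ) : Finset (ℕ × ℕ) :=
  (if 1 ≤ a ∧ (a - 1, b + 1) ∉ μ then {(a - 1, b)} else ∅) ∪
    (if 1 ≤ b ∧ (a + 1, b - 1) ∉ μ then {(a, b - 1)} else ∅)

/-- Membership in `newRemovable`. [folklore] -/
theorem mem_newRemovable {x : ℕ × ℕ} :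
    x ∈ newRemovable μ a b ↔ (1 ≤ a ∧ x = (a - 1, b) ∧ (a - 1, b + 1) ∉ μ) ∨
      (1 ≤ b ∧ x = (a, b - 1) ∧ (a + 1, b - 1) ∉ μ) := by
  unfold newRemovable
  rw [Finset.mem_union]
  apply or_congr
  · split_ifs with h
    · simp only [Finset.mem_singleton]; tauto
    · simp only [Finset.notMem_empty, false_iff]; tauto
  · split_ifs with h
    · simp only [Finset.mem_singleton]; tauto
    · simp only [Finset.notMem_empty, false_iff]; tauto

/-- The set of removable nodes after removing a node of a lower set. [folklore] -/
theorem removableNodes_erase (hμ : IsCellLowerSet μ) (hA : (a, b) ∈ μ) :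
    removableNodes (μ.erase (a, b)) = ((removableNodes μ).erase (a, b)) ∪ newRemovable μ a b := by
  ext x
  simp only [mem_removableNodes, Finset.mem_union, Finset.mem_erase, isRemovableNode_erase_iff hμ hA, ne_eq,
    mem_newRemovable]
  constructor
  · rintro ⟨hne, h | h | h⟩
    · exact Or.inl ⟨hne, h⟩
    · exact Or.inr (Or.inl h)
    · exact Or.inr (Or.inr h)
  · rintro (⟨hne, h⟩ | ⟨ha, rfl, h⟩ | ⟨hb, rfl, h⟩)
    · exact ⟨hne, Or.inl h⟩
    · exact ⟨fun e => by rw [Prod.ext_iff] at e; simp only at e; omega, Or.inr (Or.inl ⟨ha, rfl, h⟩)⟩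
    · exact ⟨fun e => by rw [Prod.ext_iff] at e; simp only at e; omega, Or.inr (Or.inr ⟨hb, rfl, h⟩)⟩

/-- Counting the addable nodes after removing a node (with any filter). [folklore] -/
theorem card_filter_addableNodes_erase (hμ : IsCellLowerSet μ) (hA : (a, b) ∈ μ) (P : ℕ × ℕ → Prop)
    [DecidablePred P] :
    (((addableNodes (μ.erase (a, b))).filter P).card : ℤ) =
      ((addableNodes μ).filter P).card + (if P (a, b) then 1 else 0) -
        (if (a + 1, b) ∈ addableNodes μ ∧ P (a + 1, b) then 1 else 0) -
        (if (a, b + 1) ∈ addableNodes μ ∧ P (a, b + 1) then 1 else 0) := by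
  have hAn : (a, b) ∉ addableNodes μ := fun h => (mem_addableNodes.1 h).1 hA
  have hX : (a, b + 1) ≠ (a + 1, b) := by simp
  have hX2 : ((a, b + 1) ∈ ((addableNodes μ).filter P).erase (a + 1, b)) ↔
      (a, b + 1) ∈ addableNodes μ ∧ P (a, b + 1) := by
    rw [Finset.mem_erase, Finset.mem_filter]; tauto
  have hX1 : ((a + 1, b) ∈ (addableNodes μ).filter P) ↔ (a + 1, b) ∈ addableNodes μ ∧ P (a + 1, b) :=
    Finset.mem_filter
  have hAn' : (a, b) ∉ (((addableNodes μ).filter P).erase (a + 1, b)).erase (a, b + 1) := by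
    simp only [Finset.mem_erase, Finset.mem_filter, not_and]
    exact fun _ _ h => (hAn h).elim
  rw [addableNodes_erase hμ hA, Finset.filter_insert, Finset.filter_erase, Finset.filter_erase]
  by_cases hPA : P (a, b)
  · rw [if_pos hPA, if_pos hPA, card_insert_int, if_neg hAn', card_erase_int, card_erase_int, if_congr hX2 rfl rfl,
      if_congr hX1 rfl rfl]
    ring
  · rw [if_neg hPA, if_neg hPA, card_erase_int, card_erase_int, if_congr hX2 rfl rfl, if_congr hX1 rfl rfl]
    ring

/-- Counting the removable nodes after removing a removable node (with any filter). [folklore] -/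
theorem card_filter_removableNodes_erase (hμ : IsCellLowerSet μ) (hA : (a, b) ∈ μ) (hA1 : (a + 1, b) ∉ μ)
    (hA2 : (a, b + 1) ∉ μ) (P : ℕ × ℕ → Prop) [DecidablePred P] :
    (((removableNodes (μ.erase (a, b))).filter P).card : ℤ) =
      ((removableNodes μ).filter P).card - (if P (a, b) then 1 else 0) +
        (if (1 ≤ a ∧ (a - 1, b + 1) ∉ μ) ∧ P (a - 1, b) then 1 else 0) +
        (if (1 ≤ b ∧ (a + 1, b - 1) ∉ μ) ∧ P (a, b - 1) then 1 else 0) := by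
  have hAr : (a, b) ∈ removableNodes μ := mem_removableNodes.2 ⟨hA, hA1, hA2⟩
  -- the new nodes are not removable in `μ`
  have hN1 : 1 ≤ a → (a - 1, b) ∉ removableNodes μ := fun ha h => by
    have := (mem_removableNodes.1 h).2.1
    exact this (by rwa [show a - 1 + 1 = a by omega])
  have hN2 : 1 ≤ b → (a, b - 1) ∉ removableNodes μ := fun hb h => by
    have := (mem_removableNodes.1 h).2.2
    exact this (by rwa [show b - 1 + 1 = b by omega])
  have hdisj : Disjoint (((removableNodes μ).erase (a, b)).filter P) ((newRemovable μ a b).filter P) := by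
    rw [Finset.disjoint_left]
    intro x hx hx'
    rw [Finset.mem_filter, Finset.mem_erase] at hx
    rw [Finset.mem_filter, mem_newRemovable] at hx'
    rcases hx'.1 with ⟨ha, rfl, -⟩ | ⟨hb, rfl, -⟩
    · exact hN1 ha hx.1.2
    · exact hN2 hb hx.1.2
  rw [removableNodes_erase hμ hA, Finset.filter_union, Finset.card_union_of_disjoint hdisj, Nat.cast_add,
    Finset.filter_erase, card_erase_int, if_congr (Finset.mem_filter.trans (and_iff_right hAr)) rfl rfl]
  -- the new part
  have hnew : (((newRemovable μ a b).filter P).card : ℤ) =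
      (if (1 ≤ a ∧ (a - 1, b + 1) ∉ μ) ∧ P (a - 1, b) then 1 else 0) +
        (if (1 ≤ b ∧ (a + 1, b - 1) ∉ μ) ∧ P (a, b - 1) then 1 else 0) := by
    unfold newRemovable
    by_cases c1 : 1 ≤ a ∧ (a - 1, b + 1) ∉ μ <;> by_cases c2 : 1 ≤ b ∧ (a + 1, b - 1) ∉ μ
    · have hne : (a - 1, b) ≠ (a, b - 1) := fun e => by rw [Prod.ext_iff] at e; simp only at e; omega
      rw [if_pos c1, if_pos c2, Finset.filter_union, Finset.filter_singleton, Finset.filter_singleton]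
      by_cases p1 : P (a - 1, b) <;> by_cases p2 : P (a, b - 1)
      · rw [if_pos p1, if_pos p2, Finset.card_union_of_disjoint (Finset.disjoint_singleton.2 hne)]
        simp [c1, c2, p1, p2]
      · rw [if_pos p1, if_neg p2]; simp [c1, p1, p2]
      · rw [if_neg p1, if_pos p2]; simp [c2, p1, p2]
      · rw [if_neg p1, if_neg p2]; simp [p1, p2]
    · rw [if_pos c1, if_neg c2, Finset.union_empty, Finset.filter_singleton]
      by_cases p1 : P (a - 1, b)
      · rw [if_pos p1]; simp [c1, c2, p1]
      · rw [if_neg p1]; simp [c2, p1]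
    · rw [if_neg c1, if_pos c2, Finset.empty_union, Finset.filter_singleton]
      by_cases p2 : P (a, b - 1)
      · rw [if_pos p2]; simp [c1, c2, p2]
      · rw [if_neg p2]; simp [c1, p2]
    · rw [if_neg c1, if_neg c2, Finset.union_empty]; simp [c1, c2]
  rw [hnew]
  ring

/-! ### The counts `d_A(μ)` restricted to a residue and to the rows below a given row -/

/-- `d(μ; j, t) := #{addable j-nodes of μ in rows > t} - #{removable j-nodes of μ in rows > t}`;
`tableauDegreeStep p f k = d(shape f_{≤k}; res (f k), row (f k))`. [folklore] -/
def degCount (p : ℕ) (μ : Finset (ℕ × ℕ)) (j : ZMod p) (t : ℕ) : ℤ :=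
  (((addableNodes μ).filter fun B => cellResidue p B = j ∧ t < B.1).card : ℤ) -
    (((removableNodes μ).filter fun B => cellResidue p B = j ∧ t < B.1).card : ℤ)

/-- The degree step of the tree's `tableauDegree` is a `degCount`. [folklore] -/
theorem tableauDegreeStep_eq_degCount {n : ℕ} (p : ℕ) (f : Fin n → ℕ × ℕ) (k : Fin n) :
    tableauDegreeStep p f k = degCount p (prefixCells f k) (cellResidue p (f k)) (f k).1 := rfl

/-- The Cartan integer `a_{ij}` of the cyclic quiver `ℤ/p` as it enters the degree:
`2[j = i] - [j = i - 1] - [j = i + 1]` (for `p = 2` the last two coincide, giving `-2`).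
[folklore] -/
def degCartan (p : ℕ) (i j : ZMod p) : ℤ :=
  2 * (if j = i then 1 else 0) - (if j = i - 1 then 1 else 0) - (if j = i + 1 then 1 else 0)

variable (p : ℕ)

/-- **Locality above**: removing an end-of-row, end-of-column node `B = (c, d)` does not change the
counts in the rows `> t` when `t ≥ c + 1`. [folklore] -/
theorem degCount_erase_of_le (hμ : IsCellLowerSet μ) {c d : ℕ} (hB : (c, d) ∈ μ) (hB1 : (c + 1, d) ∉ μ)
    (hB2 : (c, d + 1) ∉ μ) (j : ZMod p) {t : ℕ} (ht : c + 1 ≤ t) :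
    degCount p (μ.erase (c, d)) j t = degCount p μ j t := by
  unfold degCount
  rw [card_filter_addableNodes_erase hμ hB, card_filter_removableNodes_erase hμ hB hB1 hB2]
  have h1 : ¬ t < c := by omega
  have h2 : ¬ t < c + 1 := by omega
  have h3 : ¬ t < c - 1 := by omega
  simp only [h1, h2, h3, and_false, if_false]
  ring

/-- **The local change `d_B(μ ∖ A) - d_B(μ) = a_{res A, res B}`** (BKW, proof of Prop. 3.14): for a
removable node `A = (a, b)` of a lower set `μ` and a row `t < a` such that, if `A` is in row
`t + 1`, the cell `(a - 1, b + 1)` belongs to `μ` (automatic when `B ∈ μ` sits in row `t` to the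
right of `A`), removing `A` changes `d(·; j, t)` by `a_{res A, j}`. [folklore] -/
theorem degCount_erase_sub (hμ : IsCellLowerSet μ) (hA : (a, b) ∈ μ) (hA1 : (a + 1, b) ∉ μ)
    (hA2 : (a, b + 1) ∉ μ) (j : ZMod p) {t : ℕ} (ht : t < a) (ht' : a = t + 1 → (a - 1, b + 1) ∈ μ) :
    degCount p (μ.erase (a, b)) j t - degCount p μ j t = degCartan p (cellResidue p (a, b)) j := by
  -- the two addability conditions
  set X1add : Prop := b = 0 ∨ (a + 1, b - 1) ∈ μ with hX1add
  set X2add : Prop := a = 0 ∨ (a - 1, b + 1) ∈ μ with hX2add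
  have mX1 : (a + 1, b) ∈ addableNodes μ ↔ X1add := by
    rw [mem_addableNodes, IsAddableNode]
    simp only [hA1, not_false_eq_true, true_and, Nat.add_eq_zero_iff, one_ne_zero, and_false, false_or,
      Nat.add_sub_cancel, hA, true_and]
    exact Iff.rfl
  have mX2 : (a, b + 1) ∈ addableNodes μ ↔ X2add := by
    rw [mem_addableNodes, IsAddableNode]
    simp only [hA2, not_false_eq_true, true_and, Nat.add_eq_zero_iff, one_ne_zero, and_false, false_or,
      Nat.add_sub_cancel, hA, and_true]
    exact Iff.rfl
  -- residues of the four neighbours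
  have rX1 : cellResidue p (a + 1, b) = cellResidue p (a, b) - 1 := by
    unfold cellResidue; push_cast; ring
  have rX2 : cellResidue p (a, b + 1) = cellResidue p (a, b) + 1 := by
    unfold cellResidue; push_cast; ring
  have rN1 : 1 ≤ a → cellResidue p (a - 1, b) = cellResidue p (a, b) + 1 := fun ha => by
    unfold cellResidue; push_cast [Nat.cast_sub ha]; ring
  have rN2 : 1 ≤ b → cellResidue p (a, b - 1) = cellResidue p (a, b) - 1 := fun hb => by
    unfold cellResidue; push_cast [Nat.cast_sub hb]; ring
  set i := cellResidue p (a, b) with hi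
  -- the five conditions
  have cA : (cellResidue p (a, b) = j ∧ t < a) ↔ j = i := by rw [← hi]; exact ⟨fun h => h.1.symm, fun h => ⟨h.symm, ht⟩⟩
  have cX1 : ((a + 1, b) ∈ addableNodes μ ∧ (cellResidue p (a + 1, b) = j ∧ t < a + 1)) ↔ (X1add ∧ j = i - 1) := by
    rw [mX1, rX1]; constructor
    · rintro ⟨h1, h2, -⟩; exact ⟨h1, h2.symm⟩
    · rintro ⟨h1, h2⟩; exact ⟨h1, h2.symm, by omega⟩
  have cX2 : ((a, b + 1) ∈ addableNodes μ ∧ (cellResidue p (a, b + 1) = j ∧ t < a)) ↔ (X2add ∧ j = i + 1) := by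
    rw [mX2, rX2]; constructor
    · rintro ⟨h1, h2, -⟩; exact ⟨h1, h2.symm⟩
    · rintro ⟨h1, h2⟩; exact ⟨h1, h2.symm, ht⟩
  have cN1 : ((1 ≤ a ∧ (a - 1, b + 1) ∉ μ) ∧ (cellResidue p (a - 1, b) = j ∧ t < a - 1)) ↔ (¬X2add ∧ j = i + 1) := by
    constructor
    · rintro ⟨⟨ha, hm⟩, h2, -⟩
      rw [rN1 ha] at h2
      exact ⟨fun h => h.elim (fun h0 => by omega) hm, h2.symm⟩
    · rintro ⟨h1, h2⟩
      have ha : 1 ≤ a := by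
        by_contra h0; exact h1 (Or.inl (by omega))
      have hm : (a - 1, b + 1) ∉ μ := fun h => h1 (Or.inr h)
      refine ⟨⟨ha, hm⟩, by rw [rN1 ha]; exact h2.symm, ?_⟩
      by_contra hlt
      exact hm (ht' (by omega))
  have cN2 : ((1 ≤ b ∧ (a + 1, b - 1) ∉ μ) ∧ (cellResidue p (a, b - 1) = j ∧ t < a)) ↔ (¬X1add ∧ j = i - 1) := by
    constructor
    · rintro ⟨⟨hb, hm⟩, h2, -⟩
      rw [rN2 hb] at h2
      exact ⟨fun h => h.elim (fun h0 => by omega) hm, h2.symm⟩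
    · rintro ⟨h1, h2⟩
      have hb : 1 ≤ b := by
        by_contra h0; exact h1 (Or.inl (by omega))
      have hm : (a + 1, b - 1) ∉ μ := fun h => h1 (Or.inr h)
      exact ⟨⟨hb, hm⟩, by rw [rN2 hb]; exact h2.symm, ht⟩
  unfold degCount
  rw [card_filter_addableNodes_erase hμ hA, card_filter_removableNodes_erase hμ hA hA1 hA2]
  simp only []
  rw [if_congr cA rfl rfl, if_congr cX1 rfl rfl, if_congr cX2 rfl rfl, if_congr cN1 rfl rfl, if_congr cN2 rfl rfl]
  unfold degCartan
  by_cases h1 : X1add <;> by_cases h2 : X2add <;> simp only [h1, h2, true_and, false_and, if_false, not_true,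
    not_false_eq_true] <;> ring

omit p in
/-- `a_{ij} = a_{ji}`. [folklore] -/
theorem degCartan_comm (p : ℕ) (i j : ZMod p) : degCartan p i j = degCartan p j i := by
  unfold degCartan
  have e1 : (j = i) ↔ (i = j) := eq_comm
  have e2 : (j = i - 1) ↔ (i = j + 1) := by rw [eq_sub_iff_add_eq, eq_comm]
  have e3 : (j = i + 1) ↔ (i = j - 1) := by rw [eq_sub_iff_add_eq, eq_comm]
  rw [if_congr e1 rfl rfl, if_congr e2 rfl rfl, if_congr e3 rfl rfl]
  ring

/-! ### Growth sequences: the shapes of the prefixes under `s_r` -/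

section Growth

variable {n : ℕ} (f : Fin n → ℕ × ℕ) {r r' : Fin n} (h : (r' : ℕ) = r + 1)

/-- The cells of the entries `< k`. [folklore] -/
def prefixCellsLT (f : Fin n → ℕ × ℕ) (k : Fin n) : Finset (ℕ × ℕ) :=
  (Finset.univ.filter fun j : Fin n => j < k).image f

omit h in
/-- The entries `≤ k` are the entries `< k` and `k`. [folklore] -/
theorem prefixCells_eq_insert (k : Fin n) : prefixCells f k = insert (f k) (prefixCellsLT f k) := by
  unfold prefixCells prefixCellsLT
  rw [← Finset.image_insert]
  congr 1
  ext j
  simp only [Finset.mem_filter, Finset.mem_univ, true_and, Finset.mem_insert]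
  constructor
  · intro hj; exact (lt_or_eq_of_le hj).elim Or.inr Or.inl
  · rintro (rfl | hj); exacts [le_rfl, hj.le]

include h in
/-- The entries `< r + 1` are the entries `≤ r`. [folklore] -/
theorem prefixCellsLT_succ : prefixCellsLT f r' = prefixCells f r := by
  unfold prefixCells prefixCellsLT
  congr 1
  ext j
  simp only [Finset.mem_filter, Finset.mem_univ, true_and, Fin.lt_def, Fin.le_def]
  omega

include h in
/-- The entries `≤ r + 1` are the entries `< r` together with `r` and `r + 1`. [folklore] -/
theorem prefixCells_succ : prefixCells f r' = insert (f r') (insert (f r) (prefixCellsLT f r)) := by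
  rw [prefixCells_eq_insert, prefixCellsLT_succ f h, prefixCells_eq_insert]

include h in
/-- `s_r` preserves `{j ≤ k}` when `r ≤ k ↔ r + 1 ≤ k`. [folklore] -/
theorem image_swap_filter_le {k : Fin n} (hk : (r ≤ k ↔ r' ≤ k)) :
    (Finset.univ.filter fun j : Fin n => j ≤ k).image (Equiv.swap r r') =
      Finset.univ.filter fun j : Fin n => j ≤ k := by
  ext x
  simp only [Finset.mem_image, Finset.mem_filter, Finset.mem_univ, true_and]
  constructor
  · rintro ⟨j, hj, rfl⟩
    rcases eq_or_ne j r with rfl | h1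
    · rw [Equiv.swap_apply_left]; exact hk.1 hj
    rcases eq_or_ne j r' with rfl | h2
    · rw [Equiv.swap_apply_right]; exact hk.2 hj
    · rwa [Equiv.swap_apply_of_ne_of_ne h1 h2]
  · intro hx
    refine ⟨Equiv.swap r r' x, ?_, Equiv.swap_apply_self _ _ _⟩
    rcases eq_or_ne x r with rfl | h1
    · rw [Equiv.swap_apply_left]; exact hk.1 hx
    rcases eq_or_ne x r' with rfl | h2
    · rw [Equiv.swap_apply_right]; exact hk.2 hx
    · rwa [Equiv.swap_apply_of_ne_of_ne h1 h2]

include h in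
/-- For `k ∉ {r, r+1}` (and for `k = r + 1`) the prefix shapes of `f` and `f ∘ s_r` agree. [folklore] -/
theorem prefixCells_comp_swap {k : Fin n} (hk : (r ≤ k ↔ r' ≤ k)) :
    prefixCells (f ∘ Equiv.swap r r') k = prefixCells f k := by
  unfold prefixCells
  rw [← Finset.image_image, image_swap_filter_le h hk]

include h in
/-- The entries `< r` of `f ∘ s_r` and of `f` occupy the same cells. [folklore] -/
theorem prefixCellsLT_comp_swap : prefixCellsLT (f ∘ Equiv.swap r r') r = prefixCellsLT f r := by
  unfold prefixCellsLT
  rw [← Finset.image_image]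
  congr 1
  ext x
  simp only [Finset.mem_image, Finset.mem_filter, Finset.mem_univ, true_and]
  constructor
  · rintro ⟨j, hj, rfl⟩
    have h1 : j ≠ r := fun e => by subst e; exact lt_irrefl _ hj
    have h2 : j ≠ r' := fun e => by subst e; rw [Fin.lt_def] at hj; omega
    rwa [Equiv.swap_apply_of_ne_of_ne h1 h2]
  · intro hx
    have h1 : x ≠ r := fun e => by subst e; exact lt_irrefl _ hx
    have h2 : x ≠ r' := fun e => by subst e; rw [Fin.lt_def] at hx; omega
    exact ⟨x, hx, Equiv.swap_apply_of_ne_of_ne h1 h2⟩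

include h in
/-- The degree steps at `k ∉ {r, r + 1}` are unchanged by `s_r`. [folklore] -/
theorem tableauDegreeStep_comp_swap_of_ne (p : ℕ) {k : Fin n} (h1 : k ≠ r) (h2 : k ≠ r') :
    tableauDegreeStep p (f ∘ Equiv.swap r r') k = tableauDegreeStep p f k := by
  have hk : (r ≤ k ↔ r' ≤ k) := by
    rw [Fin.le_def, Fin.le_def]
    have : (k : ℕ) ≠ r := fun e => h1 (Fin.ext e)
    have : (k : ℕ) ≠ r' := fun e => h2 (Fin.ext e)
    omega
  rw [tableauDegreeStep_eq_degCount, tableauDegreeStep_eq_degCount, prefixCells_comp_swap f h hk,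
    Function.comp_apply, Equiv.swap_apply_of_ne_of_ne h1 h2]

include h in
/-- **Brundan–Kleshchev–Wang, Prop. 3.14** (for growth sequences): if the entry `r + 1` sits
strictly below and strictly left of the entry `r` (both being end-of-row, end-of-column cells of
the shape `μ` of the entries `≤ r + 1`, a lower set — as for any standard tableau), then swapping
the two entries changes the degree by `-a_{i_r, i_{r+1}}`:
`deg (s_r 𝔱) - deg 𝔱 = -a_{res_𝔱(r), res_𝔱(r+1)}`. [cite: BrundanKleshchevWang2011, Prop. 3.14] -/
theorem tableauDegree_comp_swap_sub (p : ℕ) (hf : Function.Injective f)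
    (hμ : IsCellLowerSet (prefixCells f r'))
    (hrow : (f r).1 < (f r').1) (hcol : (f r').2 < (f r).2)
    (hA1 : ((f r').1 + 1, (f r').2) ∉ prefixCells f r') (hA2 : ((f r').1, (f r').2 + 1) ∉ prefixCells f r')
    (hB1 : ((f r).1 + 1, (f r).2) ∉ prefixCells f r') (hB2 : ((f r).1, (f r).2 + 1) ∉ prefixCells f r') :
    tableauDegree p (f ∘ Equiv.swap r r') - tableauDegree p f =
      -degCartan p (cellResidue p (f r)) (cellResidue p (f r')) := by
  have hne : r ≠ r' := fun e => by rw [Fin.ext_iff] at e; omega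
  -- the shapes
  set μ := prefixCells f r' with hμd
  set ν := prefixCellsLT f r with hνd
  obtain ⟨⟨a, b⟩, hAe⟩ : ∃ x : ℕ × ℕ, f r' = x := ⟨_, rfl⟩
  obtain ⟨⟨c, d⟩, hBe⟩ : ∃ x : ℕ × ℕ, f r = x := ⟨_, rfl⟩
  simp only [hAe, hBe] at hrow hcol hA1 hA2 hB1 hB2
  have hAB : ((a, b) : ℕ × ℕ) ≠ (c, d) := fun e => by rw [Prod.ext_iff] at e; simp only at e; omega
  have hμe : μ = insert (a, b) (insert (c, d) ν) := by rw [hμd, prefixCells_succ f h, hAe, hBe]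
  have hAμ : (a, b) ∈ μ := by rw [hμe]; exact Finset.mem_insert_self _ _
  have hBμ : (c, d) ∈ μ := by rw [hμe]; exact Finset.mem_insert_of_mem (Finset.mem_insert_self _ _)
  have hBν : (c, d) ∉ ν := by
    rw [hνd, prefixCellsLT]
    simp only [Finset.mem_image, Finset.mem_filter, Finset.mem_univ, true_and, not_exists, not_and]
    intro j hj e
    exact absurd (hf (e.trans hBe.symm)) (ne_of_lt hj)
  have hAν : (a, b) ∉ insert (c, d) ν := by
    rw [Finset.mem_insert, not_or]
    refine ⟨hAB, ?_⟩
    rw [hνd, prefixCellsLT]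
    simp only [Finset.mem_image, Finset.mem_filter, Finset.mem_univ, true_and, not_exists, not_and]
    intro j hj e
    have := hf (e.trans hAe.symm)
    subst this
    rw [Fin.lt_def] at hj; omega
  have hμA : μ.erase (a, b) = insert (c, d) ν := by rw [hμe, Finset.erase_insert hAν]
  have hμB : μ.erase (c, d) = insert (a, b) ν := by
    rw [hμe, Finset.insert_comm, Finset.erase_insert]
    rw [Finset.mem_insert, not_or]; exact ⟨hAB.symm, hBν⟩
  -- the four steps
  have s1 : tableauDegreeStep p f r = degCount p (insert (c, d) ν) (cellResidue p (c, d)) c := by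
    rw [tableauDegreeStep_eq_degCount, prefixCells_eq_insert, hBe]
  have s2 : tableauDegreeStep p f r' = degCount p μ (cellResidue p (a, b)) a := by
    rw [tableauDegreeStep_eq_degCount, hAe]
  have s3 : tableauDegreeStep p (f ∘ Equiv.swap r r') r = degCount p (insert (a, b) ν) (cellResidue p (a, b)) a := by
    rw [tableauDegreeStep_eq_degCount, prefixCells_eq_insert, prefixCellsLT_comp_swap f h, Function.comp_apply,
      Equiv.swap_apply_left, hAe]
  have s4 : tableauDegreeStep p (f ∘ Equiv.swap r r') r' = degCount p μ (cellResidue p (c, d)) c := by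
    rw [tableauDegreeStep_eq_degCount, prefixCells_comp_swap f h (k := r') ⟨fun _ => le_rfl, fun _ => by
      rw [Fin.le_def]; omega⟩, Function.comp_apply, Equiv.swap_apply_right, hBe]
  -- Claim 1 and Claim 2
  have c1 : degCount p μ (cellResidue p (a, b)) a = degCount p (insert (a, b) ν) (cellResidue p (a, b)) a := by
    rw [← hμB, degCount_erase_of_le p hμ hBμ hB1 hB2 _ (by omega)]
  have c2 : degCount p (insert (c, d) ν) (cellResidue p (c, d)) c - degCount p μ (cellResidue p (c, d)) c =
      degCartan p (cellResidue p (a, b)) (cellResidue p (c, d)) := by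
    rw [← hμA]
    refine degCount_erase_sub p hμ hAμ hA1 hA2 _ hrow fun hac => ?_
    exact hμ hBμ (by simp only; omega) (by simp only; omega)
  -- sum over the steps
  unfold tableauDegree
  rw [← Finset.sum_sub_distrib, Finset.sum_eq_add r r' hne (fun k _ hk =>
    by rw [tableauDegreeStep_comp_swap_of_ne f h p hk.1 hk.2, sub_self]) (fun h => (h (Finset.mem_univ _)).elim)
    (fun h => (h (Finset.mem_univ _)).elim), s1, s2, s3, s4, hAe, hBe, degCartan_comm p (cellResidue p (c, d))]
  linear_combination (-1 : ℤ) * c1 - c2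

end Growth

/-! ### Standard tableaux -/

section Std

open Literature.NumberTheory.DiophantineGeometry (StdFilling)

variable {n : ℕ} {Y : YoungDiagram}

/-- The shape of the entries `≤ k` of a standard Young tableau is a lower set of cells. [folklore] -/
theorem isCellLowerSet_prefixCells (hn : Y.cells.card = n) (T : StdFilling n Y) (k : Fin n) :
    IsCellLowerSet (prefixCells T.1 k) := by
  intro x hx y hy1 hy2
  rw [prefixCells, Finset.mem_image] at hx ⊢
  obtain ⟨j, hj, rfl⟩ := hx
  rw [Finset.mem_filter] at hj
  have hyY : y ∈ Y := Y.up_left_mem hy1 hy2 (T.mem j)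
  obtain ⟨q, hq⟩ := T.exists_eq hn hyY
  refine ⟨q, Finset.mem_filter.2 ⟨Finset.mem_univ _, ?_⟩, hq⟩
  rcases le_or_gt q j with hqj | hjq
  · exact hqj.trans hj.2
  · exact absurd (hq ▸ Prod.mk_le_mk.2 ⟨hy1, hy2⟩ : T.1 q ≤ T.1 j) (T.not_le hjq)

/-- In the shape of the entries `≤ k`, no entry `≤ k` lies weakly south-east of the entry `k`
other than `k` itself. [folklore] -/
theorem not_mem_prefixCells_of_le (T : StdFilling n Y) {k : Fin n} {x : ℕ × ℕ} (hx : T.1 k ≤ x)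
    (hne : x ≠ T.1 k) : x ∉ prefixCells T.1 k := by
  rw [prefixCells, Finset.mem_image]
  rintro ⟨q, hq, rfl⟩
  rw [Finset.mem_filter] at hq
  rcases lt_or_eq_of_le hq.2 with hlt | rfl
  · exact T.not_le hlt hx
  · exact hne rfl

/-- **Brundan–Kleshchev–Wang, Prop. 3.14, for standard Young tableaux.** If `𝔱` is a standard
tableau of shape `Y ⊢ n` in which `r + 1` lies strictly below and strictly to the left of `r`
(equivalently: `s_r 𝔱` is again standard and `r + 1` is lower), then
`deg (s_r 𝔱) - deg 𝔱 = -a_{res_𝔱(r), res_𝔱(r+1)}`. [cite: BrundanKleshchevWang2011, Prop. 3.14] -/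
theorem tableauDegree_swap_sub_of_stdFilling (p : ℕ) (hn : Y.cells.card = n) (T : StdFilling n Y)
    {r r' : Fin n} (h : (r' : ℕ) = r + 1) (hrow : (T.1 r).1 < (T.1 r').1) (hcol : (T.1 r').2 < (T.1 r).2) :
    tableauDegree p (T.1 ∘ Equiv.swap r r') - tableauDegree p T.1 =
      -degCartan p (cellResidue p (T.1 r)) (cellResidue p (T.1 r')) := by
  have hlt : r < r' := by rw [Fin.lt_def]; omega
  have ne1 : ∀ x : ℕ × ℕ, (x.1 + 1, x.2) ≠ x := fun x e => by rw [Prod.ext_iff] at e; simp only at e; omega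
  have ne2 : ∀ x : ℕ × ℕ, (x.1, x.2 + 1) ≠ x := fun x e => by rw [Prod.ext_iff] at e; simp only at e; omega
  refine tableauDegree_comp_swap_sub T.1 h p T.injective (isCellLowerSet_prefixCells hn T r') hrow hcol ?_ ?_ ?_ ?_
  · exact not_mem_prefixCells_of_le T (Prod.mk_le_mk.2 ⟨by simp, le_rfl⟩) (ne1 _)
  · exact not_mem_prefixCells_of_le T (Prod.mk_le_mk.2 ⟨le_rfl, by simp⟩) (ne2 _)
  · -- the cell below `B`: an entry `≤ r + 1` there would be `r + 1`, which is strictly left of `B`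
    rw [prefixCells_eq_insert, prefixCellsLT_succ T.1 h, Finset.mem_insert, not_or]
    refine ⟨fun e => ?_, not_mem_prefixCells_of_le T (Prod.mk_le_mk.2 ⟨by simp, le_rfl⟩) (ne1 _)⟩
    rw [Prod.ext_iff] at e; simp only at e; omega
  · rw [prefixCells_eq_insert, prefixCellsLT_succ T.1 h, Finset.mem_insert, not_or]
    refine ⟨fun e => ?_, not_mem_prefixCells_of_le T (Prod.mk_le_mk.2 ⟨le_rfl, by simp⟩) (ne2 _)⟩
    rw [Prod.ext_iff] at e; simp only at e; omega

/-- **Brundan–Kleshchev–Wang, Lemma 3.3** (the direction used to build chains): if `𝔱` is standard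
and the cells of `r` and `r + 1` are incomparable (neither weakly north-west of the other — as
`r < r + 1` this just says that `r + 1` is not weakly south-east of `r`), then `s_r 𝔱` is again
standard. [cite: BrundanKleshchevWang2011, Lemma 3.3] -/
theorem isStdFilling_comp_swap (T : StdFilling n Y) {r r' : Fin n} (h : (r' : ℕ) = r + 1)
    (hinc : ¬ (T.1 r ≤ T.1 r')) :
    Literature.NumberTheory.DiophantineGeometry.IsStdFilling n Y (T.1 ∘ Equiv.swap r r') := by
  have hlt : r < r' := by rw [Fin.lt_def]; omega
  refine ⟨fun q => T.mem _, T.injective.comp (Equiv.injective _), fun a c hac => ?_⟩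
  simp only [Function.comp_apply]
  rcases eq_or_ne a r with rfl | ha
  · rcases eq_or_ne c r' with rfl | hc
    · rw [Equiv.swap_apply_left, Equiv.swap_apply_right]; exact hinc
    · have hc' : c ≠ a := (ne_of_lt hac).symm
      rw [Equiv.swap_apply_left, Equiv.swap_apply_of_ne_of_ne hc' hc]
      refine T.not_le (lt_of_le_of_ne ?_ hc.symm)
      exact Fin.le_def.2 (by have := Fin.lt_def.1 hac; omega)
  rcases eq_or_ne a r' with rfl | ha'
  · have hc1 : c ≠ r := fun e => by subst e; exact absurd (hlt.trans hac) (lt_irrefl _)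
    have hc2 : c ≠ a := (ne_of_lt hac).symm
    rw [Equiv.swap_apply_right, Equiv.swap_apply_of_ne_of_ne hc1 hc2]
    exact T.not_le (hlt.trans hac)
  rw [Equiv.swap_apply_of_ne_of_ne ha ha']
  rcases eq_or_ne c r with rfl | hc
  · rw [Equiv.swap_apply_left]; exact T.not_le (hac.trans hlt)
  rcases eq_or_ne c r' with rfl | hc'
  · rw [Equiv.swap_apply_right]
    refine T.not_le (lt_of_le_of_ne ?_ ha)
    exact Fin.le_def.2 (by have := Fin.lt_def.1 hac; omega)
  · rw [Equiv.swap_apply_of_ne_of_ne hc hc']; exact T.not_le hac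

/-- `s_r 𝔱` as a standard tableau (BKW Lemma 3.3). [cite: BrundanKleshchevWang2011, Lemma 3.3] -/
def stdFillingSwap (T : StdFilling n Y) {r r' : Fin n} (h : (r' : ℕ) = r + 1) (hinc : ¬ (T.1 r ≤ T.1 r')) :
    StdFilling n Y :=
  ⟨T.1 ∘ Equiv.swap r r', isStdFilling_comp_swap T h hinc⟩

/-- **Brundan–Kleshchev–Wang, Cor. 3.15 (telescoped form of Prop. 3.14).** Along a chain of
standard tableaux `𝔱_0, 𝔱_1 = s_{r_0} 𝔱_0, …, 𝔱_m = s_{r_{m-1}} 𝔱_{m-1}` in which each step moves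
`r_k + 1` from strictly below-left of `r_k` to its place (a descending chain from `𝔱^λ`, say),
`deg 𝔱_m - deg 𝔱_0 = -∑_k a_{res_{𝔱_k}(r_k), res_{𝔱_k}(r_k + 1)}` — the degree of the word
`e(𝐢^{𝔱_0}) ψ_{r_0} ⋯ ψ_{r_{m-1}}`. [cite: BrundanKleshchevWang2011, Cor. 3.15] -/
theorem tableauDegree_chain_sub (p : ℕ) (hn : Y.cells.card = n) (m : ℕ) (T : ℕ → StdFilling n Y)
    (rs rs' : Fin m → Fin n)
    (hstep : ∀ k : Fin m, ((rs' k : ℕ) = rs k + 1) ∧ (T (k + 1)).1 = (T k).1 ∘ Equiv.swap (rs k) (rs' k) ∧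
      ((T k).1 (rs k)).1 < ((T k).1 (rs' k)).1 ∧ ((T k).1 (rs' k)).2 < ((T k).1 (rs k)).2) :
    tableauDegree p (T m).1 - tableauDegree p (T 0).1 =
      -∑ k : Fin m, degCartan p (cellResidue p ((T k).1 (rs k))) (cellResidue p ((T k).1 (rs' k))) := by
  induction m with
  | zero => simp
  | succ m ih =>
    obtain ⟨h1, h2, h3, h4⟩ := hstep (Fin.last m)
    simp only [Fin.val_last] at h2
    have step := tableauDegree_swap_sub_of_stdFilling p hn (T m) h1 h3 h4
    rw [← h2] at step
    have ih' := ih (fun k => rs (Fin.castSucc k)) (fun k => rs' (Fin.castSucc k)) fun k => by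
      simpa only [Fin.val_castSucc] using hstep (Fin.castSucc k)
    rw [Fin.sum_univ_castSucc]
    simp only [Fin.val_castSucc, Fin.val_last] at step ih' ⊢
    linear_combination step + ih'

/-! ### Descending chains from the row-reading tableau (BKW §3.3) -/

/-- The number of *row inversions* of a tableau: pairs of entries `a < b` with `b` in a strictly
higher row than `a`. It vanishes exactly for the row-reading tableau `𝔱^λ` and drops by one
under each admissible step `𝔱 ↦ s_r 𝔱` moving `r + 1` down; it is the length `ℓ(w_𝔱)`.
[folklore] -/
def rowInv (f : Fin n → ℕ × ℕ) : ℕ :=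
  (Finset.univ.filter fun ab : Fin n × Fin n => ab.1 < ab.2 ∧ (f ab.2).1 < (f ab.1).1).card

/-- If some larger entry lies in a strictly higher row, then so does some `r + 1` relative to `r`
(take a row inversion `a < b` with `b - a` minimal). [folklore] -/
theorem exists_adjacent_rowInv (f : Fin n → ℕ × ℕ) (hf : rowInv f ≠ 0) :
    ∃ r r' : Fin n, (r' : ℕ) = r + 1 ∧ (f r').1 < (f r).1 := by
  rw [rowInv, Ne, Finset.card_eq_zero, Finset.filter_eq_empty_iff] at hf
  push Not at hf
  -- minimise the gap `b - a`
  classical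
  let S := Finset.univ.filter fun ab : Fin n × Fin n => ab.1 < ab.2 ∧ (f ab.2).1 < (f ab.1).1
  have hS : S.Nonempty := by
    obtain ⟨ab, -, hab⟩ := hf
    exact ⟨ab, Finset.mem_filter.2 ⟨Finset.mem_univ _, hab⟩⟩
  obtain ⟨⟨a, b⟩, hmem, hmin⟩ := S.exists_min_image (fun ab => (ab.2 : ℕ) - ab.1) hS
  rw [Finset.mem_filter] at hmem
  obtain ⟨-, hab, hrow⟩ := hmem
  simp only at hab hrow hmin
  by_cases hgap : (b : ℕ) = a + 1
  · exact ⟨a, b, hgap, hrow⟩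
  · -- the entry `a + 1` gives a smaller gap
    have hlt : (a : ℕ) + 1 < b := by have := Fin.lt_def.1 hab; omega
    let c : Fin n := ⟨a + 1, by omega⟩
    have hac : a < c := Fin.lt_def.2 (by simp [c])
    have hcb : c < b := Fin.lt_def.2 (by simp [c]; omega)
    exfalso
    rcases lt_or_ge (f c).1 (f a).1 with h1 | h1
    · have := hmin (a, c) (Finset.mem_filter.2 ⟨Finset.mem_univ _, hac, h1⟩)
      simp only [c] at this; omega
    · have h2 : (f b).1 < (f c).1 := lt_of_lt_of_le hrow h1
      have := hmin (c, b) (Finset.mem_filter.2 ⟨Finset.mem_univ _, hcb, h2⟩)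
      simp only [c] at this; omega

/-- In a standard tableau, if `r + 1` is in a strictly higher row than `r` then it is in a
strictly larger column (else `r + 1` would be weakly north-west of `r`). [folklore] -/
theorem col_lt_of_row_lt (T : StdFilling n Y) {r r' : Fin n} (h : (r' : ℕ) = r + 1)
    (hrow : (T.1 r').1 < (T.1 r).1) : (T.1 r).2 < (T.1 r').2 := by
  by_contra hle
  exact T.not_le (show r < r' from Fin.lt_def.2 (by omega)) (Prod.mk_le_mk.2 ⟨hrow.le, not_lt.1 hle⟩)

/-- An admissible step removes exactly one row inversion: swapping `r` and `r + 1` when `r + 1`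
is strictly higher turns the inversion `(r, r+1)` into a non-inversion and permutes the others.
[folklore] -/
theorem rowInv_comp_swap (f : Fin n → ℕ × ℕ) {r r' : Fin n} (h : (r' : ℕ) = r + 1)
    (hrow : (f r').1 < (f r).1) : rowInv (f ∘ Equiv.swap r r') + 1 = rowInv f := by
  classical
  have hlt : r < r' := Fin.lt_def.2 (by omega)
  set s := Equiv.swap r r' with hs
  -- `s` preserves the order of `a, b` unless `{a, b} = {r, r'}`
  have hord : ∀ a b : Fin n, (a, b) ≠ (r, r') → (a, b) ≠ (r', r) → (s a < s b ↔ a < b) := by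
    intro a b h1 h2
    rcases eq_or_ne a r with rfl | ha
    · have hb : b ≠ r' := fun e => h1 (by rw [e])
      rcases eq_or_ne b a with rfl | hb'
      · simp
      · rw [hs, Equiv.swap_apply_left, Equiv.swap_apply_of_ne_of_ne hb' hb, Fin.lt_def, Fin.lt_def]
        have : (b : ℕ) ≠ a := fun e => hb' (Fin.ext e)
        have : (b : ℕ) ≠ r' := fun e => hb (Fin.ext e)
        omega
    rcases eq_or_ne a r' with rfl | ha'
    · have hb : b ≠ r := fun e => h2 (by rw [e])
      rcases eq_or_ne b a with rfl | hb'
      · simp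
      · rw [hs, Equiv.swap_apply_right, Equiv.swap_apply_of_ne_of_ne hb hb', Fin.lt_def, Fin.lt_def]
        have : (b : ℕ) ≠ a := fun e => hb' (Fin.ext e)
        have : (b : ℕ) ≠ r := fun e => hb (Fin.ext e)
        omega
    rw [hs, Equiv.swap_apply_of_ne_of_ne ha ha']
    rcases eq_or_ne b r with rfl | hb
    · rw [Equiv.swap_apply_left, Fin.lt_def, Fin.lt_def]
      have : (a : ℕ) ≠ b := fun e => ha (Fin.ext e)
      have : (a : ℕ) ≠ r' := fun e => ha' (Fin.ext e)
      omega
    rcases eq_or_ne b r' with rfl | hb'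
    · rw [Equiv.swap_apply_right, Fin.lt_def, Fin.lt_def]
      have : (a : ℕ) ≠ r := fun e => ha (Fin.ext e)
      have : (a : ℕ) ≠ b := fun e => ha' (Fin.ext e)
      omega
    · rw [Equiv.swap_apply_of_ne_of_ne hb hb']
  -- pointwise comparison of the indicator functions after reindexing by `(a, b) ↦ (s a, s b)`
  have hpt : ∀ ab : Fin n × Fin n,
      (if ab.1 < ab.2 ∧ (f ab.2).1 < (f ab.1).1 then 1 else 0 : ℕ) =
        (if s ab.1 < s ab.2 ∧ (f ab.2).1 < (f ab.1).1 then 1 else 0) + if ab = (r, r') then 1 else 0 := by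
    rintro ⟨a, b⟩
    by_cases h1 : (a, b) = (r, r')
    · rw [Prod.ext_iff] at h1; obtain ⟨rfl, rfl⟩ := h1
      simp only [hlt, hrow, and_self, if_true, hs, Equiv.swap_apply_left, Equiv.swap_apply_right,
        lt_asymm hlt, false_and, if_false]
    by_cases h2 : (a, b) = (r', r)
    · rw [Prod.ext_iff] at h2; obtain ⟨rfl, rfl⟩ := h2
      simp only [lt_asymm hlt, if_false, hs, Equiv.swap_apply_left, Equiv.swap_apply_right,
        lt_asymm hrow, and_false, zero_add]
      rw [if_neg]; rintro e; rw [Prod.ext_iff] at e; exact absurd e.1 (ne_of_gt hlt)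
    · rw [if_neg h1, add_zero]
      exact if_congr ((hord a b h1 h2).and Iff.rfl).symm rfl rfl
  unfold rowInv
  rw [Finset.card_filter, Finset.card_filter,
    ← Equiv.sum_comp (Equiv.prodCongr s s) (fun ab : Fin n × Fin n =>
      if ab.1 < ab.2 ∧ ((f ∘ s) ab.2).1 < ((f ∘ s) ab.1).1 then 1 else 0)]
  simp only [Equiv.prodCongr_apply, Prod.map, Function.comp_apply, hs, Equiv.swap_apply_self]
  rw [Finset.sum_congr rfl (fun ab _ => hpt ab), Finset.sum_add_distrib, Finset.sum_ite_eq' Finset.univ (r, r'),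
    if_pos (Finset.mem_univ _)]

/-- A tableau without row inversions is reached from every standard tableau `𝔱` by undoing
`rowInv 𝔱` admissible steps; read forwards: **every standard tableau is the end of a descending
admissible chain** `𝔱_0, s_{r_0}𝔱_0, …` of length `rowInv 𝔱 = ℓ(w_𝔱)` starting at a tableau
with no row inversions (the row-reading tableau `𝔱^λ`), each step moving `r_k + 1` from strictly
below-left of `r_k` (BKW §3.3; Dipper–James). Combined with `tableauDegree_chain_sub` this is
BKW Cor. 3.15: `deg 𝔱 - deg 𝔱^λ = deg (e(𝐢^λ) ψ_{r_0} ⋯ ψ_{r_{m-1}})`. [cite: BrundanKleshchevWang2011, §3.3 and Cor. 3.15] -/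
theorem exists_admissible_chain (T : StdFilling n Y) :
    ∃ (m : ℕ) (Ts : ℕ → StdFilling n Y) (rs rs' : Fin m → Fin n),
      Ts m = T ∧ rowInv (Ts 0).1 = 0 ∧ m = rowInv T.1 ∧
      ∀ k : Fin m, ((rs' k : ℕ) = rs k + 1) ∧ (Ts (k + 1)).1 = (Ts k).1 ∘ Equiv.swap (rs k) (rs' k) ∧
        ((Ts k).1 (rs k)).1 < ((Ts k).1 (rs' k)).1 ∧ ((Ts k).1 (rs' k)).2 < ((Ts k).1 (rs k)).2 := by
  induction hN : rowInv T.1 using Nat.strong_induction_on generalizing T with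
  | _ N ih =>
    rcases Nat.eq_zero_or_pos N with rfl | hpos
    · exact ⟨0, fun _ => T, Fin.elim0, Fin.elim0, rfl, hN, rfl, fun k => k.elim0⟩
    · -- undo an adjacent row inversion and recurse
      obtain ⟨r, r', h, hrow⟩ := exists_adjacent_rowInv T.1 (by omega)
      have hcol := col_lt_of_row_lt T h hrow
      have hinc : ¬ (T.1 r ≤ T.1 r') := fun hle => absurd (Prod.mk_le_mk.1 hle).1 (not_le.2 hrow)
      set U := stdFillingSwap T h hinc with hUdef
      have hU1 : U.1 = T.1 ∘ Equiv.swap r r' := rfl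
      have hU : rowInv U.1 + 1 = N := by rw [← hN, hU1]; exact rowInv_comp_swap T.1 h hrow
      obtain ⟨m, Ts, rs, rs', hTm, h0, hm, hstep⟩ := ih (rowInv U.1) (by omega) U rfl
      refine ⟨m + 1, fun k => if k ≤ m then Ts k else T, Fin.snoc rs r, Fin.snoc rs' r', ?_, ?_, ?_, ?_⟩
      · simp
      · simp [h0]
      · omega
      · intro k
        refine Fin.lastCases ?_ (fun k => ?_) k
        · simp only [Fin.snoc_last, Fin.val_last, le_refl, if_true, add_le_iff_nonpos_right, nonpos_iff_eq_zero,
            one_ne_zero, if_false, hTm, hU1, Function.comp_apply, Equiv.swap_apply_left, Equiv.swap_apply_right]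
          refine ⟨h, ?_, hrow, hcol⟩
          funext x
          simp only [Function.comp_apply, Equiv.swap_apply_self]
        · have hk : (k : ℕ) < m := k.2
          simp only [Fin.snoc_castSucc, Fin.val_castSucc, if_pos hk.le, if_pos (Nat.succ_le_of_lt hk)]
          exact hstep k

/-! ### The chain starts at the row-reading tableau `𝔱^λ` -/

/-- No row inversions means the row of the entry is monotone in the entry. [folklore] -/
theorem row_monotone_of_rowInv_eq_zero (f : Fin n → ℕ × ℕ) (h0 : rowInv f = 0) {a b : Fin n}
    (hab : a ≤ b) : (f a).1 ≤ (f b).1 := by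
  rcases hab.lt_or_eq with hlt | rfl
  · rw [rowInv, Finset.card_eq_zero, Finset.filter_eq_empty_iff] at h0
    have := h0 (x := (a, b)) (Finset.mem_univ _)
    simp only [hlt, true_and, not_lt] at this
    exact this
  · exact le_rfl

/-- A down-closed set of entries is an initial segment: membership is `p < #S`. [folklore] -/
theorem mem_iff_lt_card_of_downClosed (S : Finset (Fin n)) (hS : ∀ ⦃q⦄, q ∈ S → ∀ ⦃q'⦄, q' ≤ q → q' ∈ S)
    (p : Fin n) : p ∈ S ↔ (p : ℕ) < S.card := by
  constructor
  · intro hp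
    have hsub : Finset.Iic p ⊆ S := fun q hq => hS hp (Finset.mem_Iic.1 hq)
    have := Finset.card_le_card hsub
    rw [Fin.card_Iic] at this
    omega
  · intro hp
    by_contra hnot
    have hsub : S ⊆ Finset.Iio p := fun q hq => by
      rw [Finset.mem_Iio]
      by_contra hle
      exact hnot (hS hq (not_lt.1 hle))
    have := Finset.card_le_card hsub
    rw [Fin.card_Iio] at this
    omega

/-- For a standard Young tableau with all cells filled, the number of entries in the rows `≤ i`
is the number of cells in those rows. [folklore] -/
theorem card_filter_row_le (hn : Y.cells.card = n) (T : StdFilling n Y) (i : ℕ) :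
    (Finset.univ.filter fun q : Fin n => (T.1 q).1 ≤ i).card = (Y.cells.filter fun x => x.1 ≤ i).card := by
  refine Finset.card_bij (fun q _ => T.1 q) (fun q hq => ?_) (fun q _ q' _ h => T.injective h) (fun x hx => ?_)
  · rw [Finset.mem_filter] at hq ⊢
    exact ⟨(YoungDiagram.mem_cells _).2 (T.mem q), hq.2⟩
  · rw [Finset.mem_filter] at hx
    obtain ⟨q, hq⟩ := T.exists_eq hn ((YoungDiagram.mem_cells _).1 hx.1)
    exact ⟨q, Finset.mem_filter.2 ⟨Finset.mem_univ _, by rw [hq]; exact hx.2⟩, hq⟩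

/-- **Two standard Young tableaux of the same shape without row inversions coincide** (both row
functions are monotone with the same numbers of entries per row, hence equal; a standard tableau
is determined by its rows, `StdFilling.ext_of_row_eq`). [folklore] -/
theorem eq_of_rowInv_eq_zero (hn : Y.cells.card = n) {T T' : StdFilling n Y} (h0 : rowInv T.1 = 0)
    (h0' : rowInv T'.1 = 0) : T = T' := by
  refine Literature.NumberTheory.DiophantineGeometry.StdFilling.ext_of_row_eq hn fun p => ?_
  -- `row p ≤ i ↔ p < c_i` for both tableaux
  have key : ∀ (S : StdFilling n Y), rowInv S.1 = 0 → ∀ i : ℕ, ((S.1 p).1 ≤ i ↔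
      (p : ℕ) < (Y.cells.filter fun x => x.1 ≤ i).card) := by
    intro S hS i
    rw [← card_filter_row_le hn S i, ← mem_iff_lt_card_of_downClosed _ (fun q hq q' hq' => ?_) p,
      Finset.mem_filter]
    · simp
    · rw [Finset.mem_filter] at hq ⊢
      exact ⟨Finset.mem_univ _, (row_monotone_of_rowInv_eq_zero S.1 hS hq').trans hq.2⟩
  refine le_antisymm ?_ ?_
  · exact (key T h0 _).2 ((key T' h0' _).1 le_rfl)
  · exact (key T' h0' _).2 ((key T h0 _).1 le_rfl)

/-- **The row-reading tableau `𝔱^λ`** of shape `λ ⊢ n` as a standard filling: the entries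
`0, …, n - 1` in order along the rows (the tree's `Nat.Partition.rowOf/colOf`,
`exists_isStandardFilling_rowOf_colOf`). [folklore] -/
def rowReading (μ : Nat.Partition n) : StdFilling n μ.youngDiagram :=
  ⟨fun i => (μ.rowOf i, μ.colOf i), by
    obtain ⟨f, hf, hfv⟩ := Literature.NumberTheory.DiophantineGeometry.exists_isStandardFilling_rowOf_colOf μ
    refine ⟨fun i => μ.rowOf_colOf_mem_youngDiagram i, fun i j h => f.injective (Subtype.ext ?_), fun p q hpq hle => ?_⟩
    · rw [hfv, hfv]; exact h
    · refine hf p q hpq ?_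
      rw [hfv, hfv]
      exact ⟨(Prod.mk_le_mk.1 hle).1, (Prod.mk_le_mk.1 hle).2⟩⟩

/-- The entries of `𝔱^λ`. [folklore] -/
theorem rowReading_apply (μ : Nat.Partition n) (i : Fin n) : (rowReading μ).1 i = (μ.rowOf i, μ.colOf i) := rfl

/-- `𝔱^λ` has no row inversions (`rowOf` is monotone). [folklore] -/
theorem rowInv_rowReading (μ : Nat.Partition n) : rowInv (rowReading μ).1 = 0 := by
  rw [rowInv, Finset.card_eq_zero, Finset.filter_eq_empty_iff]
  rintro ⟨a, b⟩ - ⟨hab, hrow⟩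
  simp only [rowReading_apply] at hab hrow
  have h1 : (μ.sortedParts.take (μ.rowOf b + 1)).sum ≤ (μ.sortedParts.take (μ.rowOf a)).sum :=
    μ.sortedParts.monotone_sum_take (by omega)
  have h2 := μ.sum_take_rowOf_le a
  have h3 := μ.lt_sum_take_rowOf_succ b
  have h4 : (a : ℕ) < b := Fin.lt_def.1 hab
  omega

/-- A standard `λ`-tableau without row inversions is `𝔱^λ`. [folklore] -/
theorem eq_rowReading_of_rowInv_eq_zero {μ : Nat.Partition n} (T : StdFilling n μ.youngDiagram)
    (h0 : rowInv T.1 = 0) : T = rowReading μ :=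
  eq_of_rowInv_eq_zero μ.card_cells_youngDiagram h0 (rowInv_rowReading μ)

/-- **Hu–Mathas' form of BKW Cor. 3.15.** Every standard `λ`-tableau `𝔱` is the end of a
descending admissible chain from `𝔱^λ` of length `rowInv 𝔱 = ℓ(d(𝔱))`, and along it
`deg 𝔱 - deg 𝔱^λ = -∑_k a_{res_{𝔱_k}(r_k), res_{𝔱_k}(r_k+1)} = deg (e(𝐢^λ) ψ_{r_0} ⋯ ψ_{r_{m-1}})`
(Hu–Mathas 2010, §4.3: `deg ψ_{d(𝔱)} e(𝐢^λ) = deg 𝔱 - deg 𝔱^λ`).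
[cite: HuMathas2010, §4.3] [cite: BrundanKleshchevWang2011, Cor. 3.15] -/
theorem exists_chain_tableauDegree_sub_rowReading (p : ℕ) {μ : Nat.Partition n}
    (T : StdFilling n μ.youngDiagram) :
    ∃ (m : ℕ) (Ts : ℕ → StdFilling n μ.youngDiagram) (rs rs' : Fin m → Fin n),
      Ts 0 = rowReading μ ∧ Ts m = T ∧ m = rowInv T.1 ∧
      (∀ k : Fin m, ((rs' k : ℕ) = rs k + 1) ∧ (Ts (k + 1)).1 = (Ts k).1 ∘ Equiv.swap (rs k) (rs' k) ∧
        ((Ts k).1 (rs k)).1 < ((Ts k).1 (rs' k)).1 ∧ ((Ts k).1 (rs' k)).2 < ((Ts k).1 (rs k)).2) ∧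
      tableauDegree p T.1 - tableauDegree p (rowReading μ).1 =
        -∑ k : Fin m, degCartan p (cellResidue p ((Ts k).1 (rs k))) (cellResidue p ((Ts k).1 (rs' k))) := by
  obtain ⟨m, Ts, rs, rs', hTm, h0, hm, hstep⟩ := exists_admissible_chain T
  have hT0 : Ts 0 = rowReading μ := eq_rowReading_of_rowInv_eq_zero _ h0
  refine ⟨m, Ts, rs, rs', hT0, hTm, hm, hstep, ?_⟩
  rw [← hT0, ← hTm]
  exact tableauDegree_chain_sub p μ.card_cells_youngDiagram m Ts rs rs' hstep

end Std


end Literature.RepresentationTheory.FiniteGroups
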